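import Literature.AlgebraicGeometry.HodgeTheory.AlgebraicityLocusIUnionClosedProofs
import Literature.AlgebraicGeometry.Resolution.HasSNCFieldBaseChange
import Literature.AlgebraicGeometry.Resolution.SncSaturatedCentre
import Literature.AlgebraicGeometry.HodgeTheory.HodgeGenericQbarDescentProofs
import Literature.AlgebraicGeometry.HodgeTheory.AlgebraicCyclesDefinedOverQbarProofs
import HarnessLib

/-!
# Generic local triviality of the complement of a closed subset in a smooth proper family — over a `k`-RATIONAL open

Topic `Literature/AlgebraicGeometry/HodgeTheory` (family `hodge`). Theorems only (no definition, no
named fact; D-0026). A companion of Part 2 of `AlgebraicityLocusIUnionClosedProofs`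
(`exists_opens_isLocallyTrivialFibration_compl`: for `g : X ⟶ B` proper and smooth over an
integral smooth complex `B` and `C ⊆ X` closed, over SOME dense Zariski-open `O ⊆ B` the family
`{x ∈ X(ℂ) ∖ C(ℂ) | g x ∈ O} → O(ℂ)` is a locally trivial fibration — Ehresmann relative to the
simple normal crossings boundary of an embedded log resolution of `C`, over the open where the
resolution and all strata are smooth; Voisin, *Hodge Theory I*, §9.1.1, Thm. 9.3; Dimca 1992,
Ch. 1 (3.1)). When the family and the closed subset are DEFINED OVER A SUBFIELD `k ⊆ ℂ`
(`g = g₀ ⊗_σ ℂ`, `C = C₀ ⊗_σ ℂ`), the open can be taken DEFINED OVER `k` as well: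

* `exists_opens_isLocallyTrivialFibration_compl_of_baseChangeHom` — for `σ : k →+* ℂ` (`k` of
  characteristic zero), `g₀ : X₀ ⟶ B₀` proper and smooth of relative dimension `n` between
  `k`-schemes with `X₀` integral and `B₀` integral, separated, of finite type and smooth over `k`,
  and `C₀ ⊆ X₀` closed, there is an open `O₀ ⊆ B₀` CONTAINING THE GENERIC POINT of `B₀` such that
  `{x ∈ X(ℂ) | π_X(x) ∉ C₀, π_B(g x) ∈ O₀} → {β ∈ B(ℂ) | π_B(β) ∈ O₀}` is a locally trivial
  fibration (`X = X₀ ⊗_σ ℂ`, `B = B₀ ⊗_σ ℂ`, `π_X`, `π_B` the projections).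

The point of the refinement: a complex point `t ∈ B(ℂ)` that is `k`-GENERIC (lies over the generic
point of `B₀`, Charles–Schnell Lemma 11.3.14) automatically lies over `O₀`, whereas it need not lie
in a Zariski-open of `B` produced over `ℂ`. This is how the spreading argument for the
variational Hodge conjecture places the `k`-generic parameter inside the locus of topological
local triviality (consumer: step S3′ of stub `GenericPropagation` of the crux line
`padic-disc-transport`, `Summits/HodgeConjecture/HodgeConjecture/Cruxes/VariationalHodge`).

Proof: run Part 2 OVER `k` — the embedded log resolution `π₀ : X₀' → X₀` of `C₀` exists over any
field of characteristic zero (`Resolution.exists_logResolution_of_isClosed`), and so does the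
open `O₀ ∋ η_{B₀}` over which `X₀' → B₀` and all strata of the snc boundary `E₀` are smooth
(`Resolution.HasSNC.exists_forall_smooth_strata`) — then BASE CHANGE to `ℂ`: the boundary stays
snc (`Resolution.HasSNC.comap_pullback_fst_field`), smoothness over `O₀` base-changes along the
cartesian squares `X' → X₀'`, `V(∑ K) → V(∑ K₀)` over `B → B₀` (`morphismRestrict_of_isPullback`,
`isPullback_subschemeι_comap_of_isPullback`), Part 1 (`isLocallyTrivialFibration_sncCompl`)
applies over `ℂ`, and `π(ℂ)` identifies the complement of `E(ℂ)` over `O` with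
`{x ∈ X(ℂ) ∖ C(ℂ) | g x ∈ O}` exactly as in Part 2 (`isEmbedding_map_of_isIso_morphismRestrict`,
the isomorphism locus base-changing by `isIso_morphismRestrict_of_isPullback`).

## References

* [VoisinHodgeI2002] C. Voisin, Hodge Theory and Complex Algebraic Geometry I (2002), §9.1.1,
  Thm. 9.3, Prop. 9.5.
* [CharlesSchnell2014Notes] F. Charles, C. Schnell, Notes on absolute Hodge classes (2014),
  Prop. 11.3.11 (proof), Lemma 11.3.14.
* [Voisin2007HodgeLoci] C. Voisin, Hodge loci and absolute Hodge classes, Compositio Math. 143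
  (2007), §3 (spreading over a `ℚ̄`-variety).
* [Dimca1992] A. Dimca, Singularities and Topology of Hypersurfaces (1992), Ch. 1 (3.1), (3.5).
* [Kollar2007] J. Kollár, Lectures on Resolution of Singularities (2007), Thm. 3.35.
* [Liu2002] Q. Liu, Algebraic Geometry and Arithmetic Curves (2002), Rem. 3.1.20, Prop. 4.3.38.
-/

noncomputable section

open CategoryTheory AlgebraicGeometry Limits Set TopologicalSpace IsLocalRing
open MonoidalCategory CartesianMonoidalCategory
open _root_.Topology
open Literature.AlgebraicGeometry.Motives Literature.AlgebraicGeometry.Resolution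
open Literature.AlgebraicTopology.Homotopy

namespace Literature.AlgebraicGeometry.HodgeTheory

section RationalOpen

variable {k : Type} [Field k] [CharZero k] (σ : k →+* ℂ) {X₀ B₀ : SchemeOver k} (g₀ : X₀ ⟶ B₀)
  {n d : ℕ}

/-- The function field of an integral scheme over a field of characteristic zero has
characteristic zero (it contains `k` through the structure morphism; Hartshorne II Ex. 3.6:
the function field as the local ring at the generic point). [cite: Hartshorne1977, Ch. II Ex. 3.6] -/
theorem charZero_functionField_of_charZero (B : SchemeOver k) [IsIntegral B.left] :
    CharZero B.left.functionField := by
  let φ : k →+* B.left.functionField :=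
    (B.left.presheaf.germ ⊤ (genericPoint B.left) trivial).hom.comp
      (Motives.SchemeOver.scalarRingHom B ⊤)
  exact charZero_of_injective_ringHom φ.injective

/-- **Closed subschemes of pulled-back ideal sheaves are base changes**: for a cartesian square
`(ι, l; r, b)` (`ι ≫ r = l ≫ b`) and an ideal sheaf `C` on the bottom-left corner's target `X`,
the square `(V(ι^*C) → V(C), V(ι^*C) → ·, V(C) → ·, b)` is cartesian (Mathlib's
`IdealSheafData.comapIso : V(ι^*C) ≅ X' ×_X V(C)` pasted with the given square; the case of a
base field extension is `Resolution.isPullback_subschemeι_comap`; transitivity of base change,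
Liu 2002, Rem. 3.1.20 / Görtz–Wedhorn §(4.7)). [cite: Liu2002, Rem. 3.1.20] -/
theorem isPullback_subschemeι_comap_of_isPullback {X X' Y Y' : Scheme} {ι : X' ⟶ X} {l : X' ⟶ Y'}
    {r : X ⟶ Y} {b : Y' ⟶ Y} (HX : IsPullback ι l r b) (C : X.IdealSheafData) :
    IsPullback ((C.comapIso ι).hom ≫ pullback.snd ι C.subschemeι)
      ((C.comap ι).subschemeι ≫ l) (C.subschemeι ≫ r) b := by
  have H2 : IsPullback (pullback.snd ι C.subschemeι) (pullback.fst ι C.subschemeι ≫ l)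
      (C.subschemeι ≫ r) b :=
    (IsPullback.of_hasPullback ι C.subschemeι).flip.paste_vert HX
  have H3 : IsPullback (C.comapIso ι).hom
      ((C.comapIso ι).hom ≫ (pullback.fst ι C.subschemeι ≫ l))
      (pullback.fst ι C.subschemeι ≫ l) (𝟙 _) :=
    IsPullback.of_horiz_isIso ⟨by rw [Category.comp_id]⟩
  have H4 : IsPullback ((C.comapIso ι).hom ≫ pullback.snd ι C.subschemeι)
      ((C.comapIso ι).hom ≫ (pullback.fst ι C.subschemeι ≫ l)) (C.subschemeι ≫ r) (𝟙 _ ≫ b) :=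
    H3.paste_horiz H2
  simpa using H4

/-- **Generic local triviality of the complement, over a `k`-rational open.** Let `σ : k →+* ℂ`
with `k` of characteristic zero, `g₀ : X₀ ⟶ B₀` a proper morphism of `k`-schemes, smooth of
relative dimension `n`, with `X₀` integral and `B₀` integral, separated, quasi-compact, locally of
finite type and smooth of relative dimension `d` over `k`, and `C₀ ⊆ X₀` closed. Then there is an
open `O₀ ⊆ B₀` containing the generic point of `B₀` such that, for the complexified family
`g = g₀ ⊗_σ ℂ : X ⟶ B`, the map `{x ∈ X(ℂ) | π_X x ∉ C₀, π_B (g x) ∈ O₀} → {β ∈ B(ℂ) | π_B β ∈ O₀}`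
is a locally trivial fibration. (Part 2 of `AlgebraicityLocusIUnionClosedProofs` run over `k` —
log resolution and generic smoothness of the snc strata over `k` — then base-changed to `ℂ` and
fed to the relative Ehresmann theorem `isLocallyTrivialFibration_sncCompl`.)
[cite: VoisinHodgeI2002, §9.1.1, Thm. 9.3] [cite: CharlesSchnell2014Notes, Prop. 11.3.11 (proof) and Lemma 11.3.14]
[cite: Kollar2007, Thm. 3.35] -/
theorem exists_opens_isLocallyTrivialFibration_compl_of_baseChangeHom
    [IsProper g₀.left] [SmoothOfRelativeDimension n g₀.left] [IsIntegral X₀.left]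
    [IsIntegral B₀.left] [LocallyOfFiniteType B₀.hom] [SmoothOfRelativeDimension d B₀.hom]
    [IsSeparated B₀.hom] [CompactSpace B₀.left] (C₀ : Set X₀.left) (hC₀ : IsClosed C₀) :
    ∃ O₀ : B₀.left.Opens, genericPoint B₀.left ∈ O₀ ∧
      IsLocallyTrivialFibration
        (fun x : {x : ComplexPoints ((baseChangeHom σ).obj X₀) //
            baseChangeHomFst σ X₀ x.pt ∉ C₀ ∧
              baseChangeHomFst σ B₀ (((baseChangeHom σ).map g₀).left x.pt) ∈ O₀} =>
          (⟨AlgPoints.map ((baseChangeHom σ).map g₀) x.1, x.2.2⟩ :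
            {β : ComplexPoints ((baseChangeHom σ).obj B₀) // baseChangeHomFst σ B₀ β.pt ∈ O₀})) := by
  classical
  letI := σ.toAlgebra
  haveI : PerfectField k := PerfectField.ofCharZero
  -- ### standing instances over `k`
  haveI : LocallyOfFiniteType X₀.hom := by rw [← Over.w g₀]; infer_instance
  haveI : IsSeparated X₀.hom := by rw [← Over.w g₀]; infer_instance
  haveI : SmoothOfRelativeDimension (n + d) X₀.hom := by rw [← Over.w g₀]; infer_instance
  haveI : CompactSpace X₀.left := QuasiCompact.compactSpace_of_compactSpace g₀.left
  haveI : QuasiCompact X₀.hom := (quasiCompact_iff_compactSpace X₀.hom).mpr inferInstance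
  haveI : IsLocallyNoetherian X₀.left := LocallyOfFiniteType.isLocallyNoetherian X₀.hom
  haveI : IsLocallyNoetherian B₀.left := LocallyOfFiniteType.isLocallyNoetherian B₀.hom
  have hXreg : Scheme.IsRegular X₀.left := fun x =>
    isRegularLocalRing_stalk_of_smoothOfRelativeDimension X₀.hom (n + d) x
  haveI : CharZero B₀.left.functionField := charZero_functionField_of_charZero B₀
  -- ### the empty case
  by_cases hC₀ne : C₀ = Set.univ
  · subst hC₀ne
    refine ⟨⊤, Opens.mem_top _, ?_⟩
    haveI : IsEmpty {x : ComplexPoints ((baseChangeHom σ).obj X₀) //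
        baseChangeHomFst σ X₀ x.pt ∉ (Set.univ : Set X₀.left) ∧
          baseChangeHomFst σ B₀ (((baseChangeHom σ).map g₀).left x.pt) ∈ (⊤ : B₀.left.Opens)} :=
      ⟨fun x => x.2.1 (Set.mem_univ _)⟩
    exact IsLocallyTrivialFibration.of_isEmpty _
  -- ### the log resolution of `C₀`, over `k`
  obtain ⟨X₀', π₀, E₀, hπ₀, hint', hreg', hiso₀, hE₀, hpre₀⟩ :=
    exists_logResolution_of_isClosed (k := k) X₀.hom hXreg hC₀ hC₀ne
  haveI := hπ₀
  haveI := hint'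
  let X₀'ₒ : SchemeOver k := Over.mk (π₀ ≫ X₀.hom)
  let π₀ₒ : X₀'ₒ ⟶ X₀ := Over.homMk π₀ rfl
  -- `X₀' → B₀` as a plain morphism of schemes (instances attach to it)
  let g₀'l : X₀' ⟶ B₀.left := π₀ ≫ g₀.left
  haveI : IsProper π₀ := hπ₀
  haveI : IsProper g₀'l := inferInstanceAs (IsProper (π₀ ≫ g₀.left))
  haveI : LocallyOfFiniteType g₀'l := inferInstanceAs (LocallyOfFiniteType (π₀ ≫ g₀.left))
  have hltX₀' : LocallyOfFiniteType (π₀ ≫ X₀.hom) := inferInstance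
  haveI : LocallyOfFiniteType X₀'ₒ.hom := hltX₀'
  haveI : IsSeparated X₀'ₒ.hom := inferInstanceAs (IsSeparated (π₀ ≫ X₀.hom))
  haveI : CompactSpace X₀' := QuasiCompact.compactSpace_of_compactSpace π₀
  haveI : IsLocallyNoetherian X₀' := LocallyOfFiniteType.isLocallyNoetherian (π₀ ≫ X₀.hom)
  haveI : Smooth X₀'ₒ.hom := smooth_of_isRegular_of_perfectField (π₀ ≫ X₀.hom) hreg'
  haveI : IrreducibleSpace X₀'ₒ.left := inferInstanceAs (IrreducibleSpace X₀')
  obtain ⟨N', hN'⟩ := exists_smoothOfRelativeDimension_of_smooth X₀'ₒ.hom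
  haveI := hN'
  -- ### generic smoothness of `X₀' → B₀` and of the strata of `E₀`, over `k`
  haveI : LocallyOfFinitePresentation g₀'l :=
    locallyOfFinitePresentation_of_isLocallyNoetherian g₀'l
  haveI : ∀ T : Finset X₀'.IdealSheafData,
      LocallyOfFinitePresentation ((T.sup id).subschemeι ≫ g₀'l) := fun T =>
    locallyOfFinitePresentation_of_isLocallyNoetherian _
  obtain ⟨O₀, hηO₀, hgO₀, hstrata₀⟩ := hE₀.exists_forall_smooth_strata g₀'l
  refine ⟨O₀, hηO₀, ?_⟩
  -- ### base change to `ℂ`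
  let X : SchemeOver ℂ := (baseChangeHom σ).obj X₀
  let B : SchemeOver ℂ := (baseChangeHom σ).obj B₀
  let X' : SchemeOver ℂ := (baseChangeHom σ).obj X₀'ₒ
  let g : X ⟶ B := (baseChangeHom σ).map g₀
  let π : X' ⟶ X := (baseChangeHom σ).map π₀ₒ
  let g' : X' ⟶ B := (baseChangeHom σ).map (π₀ₒ ≫ g₀)
  have hg' : g' = π ≫ g := (baseChangeHom σ).map_comp π₀ₒ g₀
  let prX : X.left ⟶ X₀.left := baseChangeHomFst σ X₀
  let prB : B.left ⟶ B₀.left := baseChangeHomFst σ B₀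
  let prX' : X'.left ⟶ X₀' := baseChangeHomFst σ X₀'ₒ
  let E : List X'.left.IdealSheafData := E₀.map fun D => D.comap prX'
  let O : B.left.Opens := prB ⁻¹ᵁ O₀
  -- cartesian squares of the base change
  have Hg' : IsPullback prX' g'.left g₀'l prB := (isPullback_baseChange_map_left ℂ (π₀ₒ ≫ g₀)).flip
  have Hπ : IsPullback prX' π.left π₀ prX := (isPullback_baseChange_map_left ℂ π₀ₒ).flip
  have Hg : IsPullback prX g.left g₀.left prB := (isPullback_baseChange_map_left ℂ g₀).flip
  -- instances on the complexified schemes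
  haveI : SmoothOfRelativeDimension N' X'.hom := smoothOfRelativeDimension_baseChangeHom_hom σ N' X₀'ₒ
  haveI : SmoothOfRelativeDimension d B.hom := smoothOfRelativeDimension_baseChangeHom_hom σ d B₀
  haveI : LocallyOfFiniteType X'.hom := by
    change LocallyOfFiniteType (pullback.snd X₀'ₒ.hom (Spec.map (CommRingCat.ofHom σ)))
    infer_instance
  haveI : LocallyOfFiniteType B.hom := by
    change LocallyOfFiniteType (pullback.snd B₀.hom (Spec.map (CommRingCat.ofHom σ)))
    infer_instance
  haveI : IsSeparated X'.hom := by
    change IsSeparated (pullback.snd X₀'ₒ.hom (Spec.map (CommRingCat.ofHom σ)))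
    infer_instance
  haveI : IsSeparated B.hom := by
    change IsSeparated (pullback.snd B₀.hom (Spec.map (CommRingCat.ofHom σ)))
    infer_instance
  haveI : IsProper g'.left := MorphismProperty.of_isPullback (P := @IsProper) Hg' inferInstance
  haveI : QuasiCompact X₀'ₒ.hom := inferInstanceAs (QuasiCompact (π₀ ≫ X₀.hom))
  haveI : QuasiCompact B₀.hom := (quasiCompact_iff_compactSpace B₀.hom).mpr inferInstance
  haveI : QuasiCompact X'.hom := by
    change QuasiCompact (pullback.snd X₀'ₒ.hom (Spec.map (CommRingCat.ofHom σ)))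
    infer_instance
  haveI : QuasiCompact B.hom := by
    change QuasiCompact (pullback.snd B₀.hom (Spec.map (CommRingCat.ofHom σ)))
    infer_instance
  haveI : CompactSpace X'.left := QuasiCompact.compactSpace_of_compactSpace X'.hom
  haveI : CompactSpace B.left := QuasiCompact.compactSpace_of_compactSpace B.hom
  haveI : SecondCountableTopology (ComplexPoints X') :=
    ComplexPoints.secondCountableTopology_of_compactSpace_holds X'
  haveI : SecondCountableTopology (ComplexPoints B) :=
    ComplexPoints.secondCountableTopology_of_compactSpace_holds B
  -- the snc boundary base-changes
  have hE : HasSNC E := HasSNC.comap_pullback_fst_field X₀'ₒ.hom ℂ hE₀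
  -- smoothness over `O` base-changes
  have hgO : Smooth (g'.left ∣_ O) := morphismRestrict_of_isPullback (W := @Smooth) Hg' O₀ hgO₀
  have hstrata : ∀ T : Finset X'.left.IdealSheafData, (∀ K ∈ T, K ∈ E) →
      Smooth (((T.sup id).subschemeι ≫ g'.left) ∣_ O) := by
    intro T hT
    -- the members of `E₀` whose pull-backs lie in `T`
    let T₀ : Finset X₀'.IdealSheafData := E₀.toFinset.filter fun D => D.comap prX' ∈ T
    have hT₀E : ∀ K ∈ T₀, K ∈ E₀ := fun K hK => List.mem_toFinset.1 (Finset.mem_filter.1 hK).1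
    have hsup : T.sup id = (T₀.sup id).comap prX' := by
      apply le_antisymm
      · refine Finset.sup_le fun K hK => ?_
        obtain ⟨D, hD, hDK⟩ := List.mem_map.1 (hT K hK)
        have hDT₀ : D ∈ T₀ := Finset.mem_filter.2 ⟨List.mem_toFinset.2 hD, hDK ▸ hK⟩
        rw [id, ← hDK]
        exact Scheme.IdealSheafData.comap_mono (f := prX') (Finset.le_sup (f := id) hDT₀)
      · rw [comap_finsetSup]
        refine Finset.sup_le fun K hK => ?_
        obtain ⟨D, hD, rfl⟩ := Finset.mem_image.1 hK
        exact Finset.le_sup (f := id) (Finset.mem_filter.1 hD).2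
    rw [hsup]
    have HS := isPullback_subschemeι_comap_of_isPullback Hg' (T₀.sup id)
    exact morphismRestrict_of_isPullback (W := @Smooth) HS O₀ (hstrata₀ T₀ hT₀E)
  -- ### Ehresmann relative to the snc boundary
  have hF := isLocallyTrivialFibration_sncCompl (N := N') (d := d) g' O hE hgO hstrata
  -- ### identification of the complement of `E(ℂ)` over `O` with `{x ∈ X(ℂ) ∖ C(ℂ) | g x ∈ O}`
  let X'V : SchemeOver ℂ := openSubschemeOver X' (g'.left ⁻¹ᵁ O)
  let jV : X'V ⟶ X' := openSubschemeOverι X' (g'.left ⁻¹ᵁ O)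
  let BO : SchemeOver ℂ := openSubschemeOver B O
  let jO : BO ⟶ B := openSubschemeOverι B O
  haveI : IsOpenImmersion jV.left := inferInstanceAs (IsOpenImmersion (g'.left ⁻¹ᵁ O).ι)
  haveI : IsOpenImmersion jO.left := inferInstanceAs (IsOpenImmersion O.ι)
  let Src := {x' : ComplexPoints X'V // ∀ D : {D // D ∈ E}, (g'.left ⁻¹ᵁ O).ι x'.pt ∉ D.1.support}
  let Tgt : Set (ComplexPoints X) :=
    {x | prX x.pt ∉ C₀ ∧ prB (g.left x.pt) ∈ O₀}
  -- naturality of the projections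
  have hππ : ∀ z : X'.left, prX (π.left z) = π₀ (prX' z) := fun z => by
    have h : (π.left ≫ prX) z = (prX' ≫ π₀) z := by rw [Hπ.w]
    rwa [Scheme.Hom.comp_apply, Scheme.Hom.comp_apply] at h
  have hg'l : g'.left = π.left ≫ g.left := by rw [hg']; rfl
  -- membership in the boundary versus membership in `C₀`
  have hbdry : ∀ z : X'.left, (∀ D : {D // D ∈ E}, z ∉ D.1.support) ↔ prX (π.left z) ∉ C₀ := by
    intro z
    have h := Set.ext_iff.1 hpre₀ (prX' z)
    simp only [Set.mem_preimage, Set.mem_iUnion, exists_prop] at h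
    rw [hππ]
    constructor
    · intro hz hC'
      obtain ⟨D, hD, hzD⟩ := h.1 hC'
      refine hz ⟨D.comap prX', List.mem_map.2 ⟨D, hD, rfl⟩⟩ ?_
      change z ∈ ((D.comap prX').support : Set X'.left)
      rw [Scheme.IdealSheafData.support_comap]
      exact hzD
    · intro hz D hzD
      obtain ⟨D₀, hD₀, hD₀D⟩ := List.mem_map.1 D.2
      have hz' : z ∈ ((D₀.comap prX').support : Set X'.left) := by rw [hD₀D]; exact hzD
      rw [Scheme.IdealSheafData.support_comap] at hz'
      exact hz (h.2 ⟨D₀, hD₀, hz'⟩)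
  -- `π(ℂ)` is an embedding off `C`
  let U₀ : X₀.left.Opens := ⟨C₀ᶜ, hC₀.isOpen_compl⟩
  let U : X.left.Opens := prX ⁻¹ᵁ U₀
  haveI : IsIso (π₀ ∣_ U₀) := hiso₀
  haveI : IsIso (π.left ∣_ U) := isIso_morphismRestrict_of_isPullback Hπ U₀
  obtain ⟨hπre, hπrr⟩ := isEmbedding_map_of_isIso_morphismRestrict π U
  -- the map `Src → X(ℂ)`
  let F : Src → ComplexPoints X := fun x' => AlgPoints.map π (AlgPoints.map jV x'.1)
  have hFmem : ∀ x' : Src, (AlgPoints.map jV x'.1).pt ∈ π.left ⁻¹ᵁ U := fun x' => by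
    change prX (π.left ((g'.left ⁻¹ᵁ O).ι x'.1.pt)) ∈ (C₀ᶜ : Set X₀.left)
    exact (hbdry _).1 x'.2
  let κ : Src → {z : ComplexPoints X' // z.pt ∈ π.left ⁻¹ᵁ U} := fun x' =>
    ⟨AlgPoints.map jV x'.1, hFmem x'⟩
  have hκ : IsEmbedding κ :=
    ((AlgPoints.isOpenEmbedding_map_holds jV).isEmbedding.comp IsEmbedding.subtypeVal).codRestrict
      {z : ComplexPoints X' | z.pt ∈ π.left ⁻¹ᵁ U} hFmem
  have hFfac : F = (fun z : {z : ComplexPoints X' // z.pt ∈ π.left ⁻¹ᵁ U} =>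
      (AlgPoints.map π z.1 : ComplexPoints X)) ∘ κ := rfl
  have hFe : IsEmbedding F := by
    rw [hFfac]
    exact hπre.comp hκ
  -- its range
  have hrjV : Set.range (AlgPoints.map jV : ComplexPoints X'V → ComplexPoints X') =
      {z | z.pt ∈ g'.left ⁻¹ᵁ O} := by
    rw [AlgPoints.range_map_of_isOpenImmersion_holds jV]
    ext Q
    change Q.pt ∈ (g'.left ⁻¹ᵁ O).ι.opensRange ↔ Q.pt ∈ g'.left ⁻¹ᵁ O
    rw [Scheme.Opens.opensRange_ι]
  have hg'pt : ∀ z : ComplexPoints X', g.left (AlgPoints.map π z).pt = g'.left z.pt := fun z => by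
    rw [hg'l]; rfl
  have hmap : ∀ y : ComplexPoints X', AlgPoints.map g' y = AlgPoints.map g (AlgPoints.map π y) :=
    fun y => by rw [hg', AlgPoints.map_comp_apply]
  have hFrange : Set.range F = Tgt := by
    ext x
    constructor
    · rintro ⟨x', rfl⟩
      refine ⟨?_, ?_⟩
      · exact (hbdry _).1 x'.2
      · change prB (g.left (AlgPoints.map π (AlgPoints.map jV x'.1)).pt) ∈ O₀
        rw [hg'pt]
        change g'.left ((g'.left ⁻¹ᵁ O).ι x'.1.pt) ∈ O
        rw [Scheme.Opens.ι_apply]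
        exact (x'.1.pt).2
    · rintro ⟨hxC, hxO⟩
      have hxU : x.pt ∈ U := hxC
      obtain ⟨⟨z, hzU⟩, hz⟩ : x ∈ Set.range (fun z : {z : ComplexPoints X' // z.pt ∈ π.left ⁻¹ᵁ U} =>
          (AlgPoints.map π z.1 : ComplexPoints X)) := by rw [hπrr]; exact hxU
      have hz' : AlgPoints.map π z = x := hz
      have hzO : z.pt ∈ g'.left ⁻¹ᵁ O := by
        change g'.left z.pt ∈ O
        rw [← hg'pt z, hz']
        exact hxO
      obtain ⟨x', rfl⟩ : z ∈ Set.range (AlgPoints.map jV : ComplexPoints X'V → _) := by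
        rw [hrjV]; exact hzO
      have hx' : ∀ D : {D // D ∈ E}, (g'.left ⁻¹ᵁ O).ι x'.pt ∉ D.1.support := (hbdry _).2 hzU
      exact ⟨⟨x', hx'⟩, hz'⟩
  -- the homeomorphisms
  obtain ⟨α, hα⟩ := exists_homeomorph_of_range_eq (i := (Subtype.val : ↥Tgt → ComplexPoints X))
    IsEmbedding.subtypeVal hFe (by rw [hFrange]; exact Subtype.range_coe)
  have hrjO : Set.range (AlgPoints.map jO : ComplexPoints BO → ComplexPoints B) =
      {β | β.pt ∈ O} := by
    rw [AlgPoints.range_map_of_isOpenImmersion_holds jO]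
    ext Q
    change Q.pt ∈ O.ι.opensRange ↔ Q.pt ∈ O
    rw [Scheme.Opens.opensRange_ι]
  obtain ⟨β, hβ⟩ := exists_homeomorph_of_range_eq
    (i := (Subtype.val : {β : ComplexPoints B // prB β.pt ∈ O₀} → ComplexPoints B))
    IsEmbedding.subtypeVal (AlgPoints.isOpenEmbedding_map_holds jO).isEmbedding
    (by rw [hrjO]; exact Subtype.range_coe)
  -- ### transport
  refine IsLocallyTrivialFibration.of_homeomorph hF α β fun x => ?_
  apply (AlgPoints.isOpenEmbedding_map_holds jO).injective
  change AlgPoints.map jO (AlgPoints.map (restrictOverHom g' O) (α x).1) = AlgPoints.map jO (β _)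
  rw [hβ, ← AlgPoints.map_comp_apply (restrictOverHom g' O) jO, restrictOverHom_comp_openSubschemeOverι,
    AlgPoints.map_comp_apply]
  change AlgPoints.map g' (AlgPoints.map jV (α x).1) = AlgPoints.map g x.1
  rw [hmap]
  exact congrArg (AlgPoints.map g) (hα x)

end RationalOpen

end Literature.AlgebraicGeometry.HodgeTheory

end
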